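import Summits.ValiantsHypothesis.ValiantsHypothesis.Theorems.SymPencilBoxFourEquality
import Mathlib.Data.Complex.Basic

/-!
# Route `SymPencil` — crux `SdcSuperquadratic` (stmt-ValiantsHypothesis-5674), line `box_four`
# (`Cruxes/SdcSuperquadratic/Lines/box_four.lean`, RUNG target `SdcPerFourTwentyOne` = `sdc(per_4) ≥ 21`):
# the registered stub `stub_boxFourEq`, landed by name

The mathematics is the BoxFour EQUALITY CASE proved by prover val-width-5676-p2 g3
(`SymPencilBoxFourEquality.two_rows_or_two_cols`, p572599, any field of characteristic `0`): an
`8`-dimensional space of `4 × 4` matrices on which all `3 × 3` minor-permanents vanish has two zero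
rows or two zero columns.  This file only states the `ℂ`-instance exactly as registered in the
skeleton, so that the line's composition `twentyOne_le_of` can cite the stub by name.

Honest framing: bookkeeping for a FINITE-RUNG line; the crux `SdcSuperquadratic` stays open and
`VP ≠ VNP` is not moved.  No definitions, no named facts. [folklore]
-/

noncomputable section

-- single-conjunct layout: Sub = Summit, duplicated namespace component intended
set_option linter.dupNamespace false

namespace Summit.ValiantsHypothesis.ValiantsHypothesis.Theorems.SymPencilSdcSuperquadraticStubBoxFourEq

open Module
open Summit.ValiantsHypothesis.ValiantsHypothesis.Theorems.SymPencilBoxFourEquality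

/-- **The registered stub `stub_boxFourEq` of the line `box_four`** (crux `SdcSuperquadratic`,
stmt-ValiantsHypothesis-5674), verbatim: the `ℂ`-instance of
`SymPencilBoxFourEquality.two_rows_or_two_cols` (val-width-5676-p2 g3). [folklore] -/
theorem stub_boxFourEq :
    ∀ W : Submodule ℂ (Fin 4 × Fin 4 → ℂ),
      (∀ x ∈ W, ∀ (r c : Fin 3 → Fin 4), Function.Injective r → Function.Injective c →
        ((Matrix.of fun i j => x (i, j)).submatrix r c).permanent = 0) →
      finrank ℂ W = 8 →
      (∃ p q : Fin 4, p ≠ q ∧ ∀ x ∈ W, ∀ j, x (p, j) = 0 ∧ x (q, j) = 0) ∨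
      (∃ p q : Fin 4, p ≠ q ∧ ∀ x ∈ W, ∀ i, x (i, p) = 0 ∧ x (i, q) = 0) :=
  fun W hW h8 => two_rows_or_two_cols W hW h8

end Summit.ValiantsHypothesis.ValiantsHypothesis.Theorems.SymPencilSdcSuperquadraticStubBoxFourEq

end
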